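import Summits.CriticalPhenomena.PercolationContinuityZ3.Theorems.PercNearOneGluingNoHeavyLowerTailKNGoodOneLayerExpansion
import HarnessLib

/-!
# Hair transfer: the goodness functional of a two-port star glued to a sure twin equals that of the twin carrying both hairs
# (`NoHeavyLowerTail` cell, stmt-CriticalPhenomena-4575; prover `prim-hp-2`, deletion–contraction line, gen 8)

Support file (`--supports stmt-CriticalPhenomena-4575`).  No definitions, no named facts, no sorries.

In the goodness induction (`KNGoodSeries.knGood_series_of_gluing`) the gluing inequality GC is a statement about the graph `(G − o) + xy`
in which the two children `x, y` of the observer are joined by a SURE pair.  When `x` is a pendant star with ports `p₁, p₂` (hairs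
`h₁, h₂`; every other pair at `x` of weight `0`), contracting the sure pair moves the two hairs onto `y`:

* `KNGoodTwoTwo.agood_hairTransfer` — with `u* := u₀[s(x,y) ↦ 1]` and `W₁ := (u₀ with x killed)[s(y,p₁) ↦ h₁, s(y,p₂) ↦ h₂]`
  (`u₀ s(y,pᵢ) = 0`):  `agood(u*, x; j) = agood(W₁, y; j)`  for `j ∈ A ∌ x`, `b ≠ x`, where
  `agood(w, v; j) := μ_w(v ↔ b) − μ_w(j ↔ b) + Σ_{W ∩ A = ∅} μ_w(C(v) = W)·min_{a∈A} μ_w(a ↔ b off W)`.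
  Proof: both sides are affine in the two hairs (`KNGoodSeriesTools.agood_affine_pair`); at a corner where `x` (resp. `y`) holds a sure hair to a
  port the correction sums vanish and the two reliabilities agree through the common refinement in which the port is joined surely to both
  twins (`real_openConn_attachPendant`, `real_openConn_gluePairs_of_asJoined`); at the hairless corner it is `KNGoodSeriesGlue.agood_wzero_glue_one`.
With `y` a two-port star as well this feeds `KNGoodTwoTwo.agood_oneLayer_twoTwo_nonneg`.
-/

namespace Summit.CriticalPhenomena.PercolationContinuityZ3.Theorems

open MeasureTheory Set ProbabilityTheory Literature.Probability.LatticeModels Literature.Probability.Percolation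

noncomputable section
open Classical

namespace KNGoodTwoTwo
open UpsetExchange KNGoodAux KNGoodSeries

variable {n : ℕ}

/-- A diagonal "pair" is joined to itself: `μ(a ↮ a) = 0`. [folklore] -/
theorem real_compl_openConn_self (g : Sym2 (Fin n) → unitInterval) (a : Fin n) :
    (prodBernoulli g).real (openConn a a)ᶜ = 0 := by
  have : ((openConn a a)ᶜ : Set (BondConfig (Fin n))) = ∅ := by
    ext ω; simp only [mem_compl_iff, mem_empty_iff_false, iff_false, not_not]; exact (SimpleGraph.Reachable.refl a :)
  rw [this, measureReal_empty]

/-- On a sure pair to a relay the correction sum of the goodness functional vanishes: if `w s(v,t) = 1` with `t ∈ A`, `t ≠ v`, then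
`μ_w(C(v) = W) = 0` for every `W` with `W ∩ A = ∅`. [cite: KozmaNitzan2024, §3.2 Definition (p. 12)] -/
theorem sum_clusterIs_eq_zero_of_surePair (w : Sym2 (Fin n) → unitInterval) (A : Finset (Fin n)) (hA : A.Nonempty)
    (v t b : Fin n) (htA : t ∈ A) (hvt : v ≠ t) (h1 : w s(v, t) = 1) :
    ∑ W ∈ nullSets A, (prodBernoulli w).real (clusterIs v W) *
        A.inf' hA (fun a => (prodBernoulli w).real (openConnIn ((↑W : Set (Fin n))ᶜ) a b)) = 0 := by
  refine Finset.sum_eq_zero fun W hW => ?_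
  have htW : t ∉ W := fun h => Finset.disjoint_left.1 (mem_nullSets.1 hW) h htA
  have hsub : (clusterIs v W : Set (BondConfig (Fin n))) ⊆ (openConn v t)ᶜ := by
    intro ω hω hvt'
    rw [mem_clusterIs] at hω
    have : t ∈ openCluster ω v := hvt'
    rw [hω] at this
    exact htW (Finset.mem_coe.1 this)
  have h0 : (prodBernoulli w).real (clusterIs v W) = 0 :=
    le_antisymm ((measureReal_mono hsub (measure_ne_top _ _)).trans
      (le_of_eq (real_not_openConn_eq_zero_of_surePair w v t hvt h1))) measureReal_nonneg
  rw [h0, zero_mul]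

/-- **Hair transfer at a sure-hair corner.**  `x ≠ y`, ports `p₁ ≠ p₂` distinct from `x, y` and in `A`, `T ⊆ {p₁,p₂}` nonempty;
`g_T`: `x` joined surely to `y` and to the ports of `T`, its other hairs closed; `g'_T`: the same sure hairs held by `y`, `x` isolated.  Then
`agood(g_T, x; j) = agood(g'_T, y; j)` (`j, b ≠ x`). [cite: KozmaNitzan2024, Lemma 5 (p. 13); folklore (contraction of a sure pair)] -/
theorem agood_transfer_corner (u₀ : Sym2 (Fin n) → unitInterval) (A T : Finset (Fin n)) (hA : A.Nonempty)
    (x y p₁ p₂ j b : Fin n) (hxy : x ≠ y) (hxp₁ : x ≠ p₁) (hxp₂ : x ≠ p₂) (hyp₁ : y ≠ p₁) (hyp₂ : y ≠ p₂) (hp : p₁ ≠ p₂)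
    (hp₁A : p₁ ∈ A) (hp₂A : p₂ ∈ A) (hTsub : T ⊆ {p₁, p₂}) (hT : T.Nonempty) (hjx : j ≠ x) (hbx : b ≠ x)
    (hx0 : ∀ z : Fin n, z ≠ p₁ → z ≠ p₂ → u₀ s(x, z) = 0) (hy0₁ : u₀ s(y, p₁) = 0) (hy0₂ : u₀ s(y, p₂) = 0) :
    (prodBernoulli (fun f : Sym2 (Fin n) => if f = s(x, p₂) then (if p₂ ∈ T then 1 else 0) else if f = s(x, p₁) then (if p₁ ∈ T then 1 else 0)
        else if f = s(x, y) then 1 else u₀ f)).real (openConn x b) -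
      (prodBernoulli (fun f : Sym2 (Fin n) => if f = s(x, p₂) then (if p₂ ∈ T then 1 else 0) else if f = s(x, p₁) then (if p₁ ∈ T then 1 else 0)
        else if f = s(x, y) then 1 else u₀ f)).real (openConn j b) +
      ∑ W ∈ nullSets A, (prodBernoulli (fun f : Sym2 (Fin n) => if f = s(x, p₂) then (if p₂ ∈ T then 1 else 0)
          else if f = s(x, p₁) then (if p₁ ∈ T then 1 else 0) else if f = s(x, y) then 1 else u₀ f)).real (clusterIs x W) *
        A.inf' hA (fun a => (prodBernoulli (fun f : Sym2 (Fin n) => if f = s(x, p₂) then (if p₂ ∈ T then 1 else 0)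
          else if f = s(x, p₁) then (if p₁ ∈ T then 1 else 0) else if f = s(x, y) then 1 else u₀ f)).real (openConnIn ((↑W : Set (Fin n))ᶜ) a b)) =
    (prodBernoulli (fun f : Sym2 (Fin n) => if f = s(y, p₂) then (if p₂ ∈ T then 1 else 0) else if f = s(y, p₁) then (if p₁ ∈ T then 1 else 0)
        else if x ∈ f then 0 else u₀ f)).real (openConn y b) -
      (prodBernoulli (fun f : Sym2 (Fin n) => if f = s(y, p₂) then (if p₂ ∈ T then 1 else 0) else if f = s(y, p₁) then (if p₁ ∈ T then 1 else 0)
        else if x ∈ f then 0 else u₀ f)).real (openConn j b) +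
      ∑ W ∈ nullSets A, (prodBernoulli (fun f : Sym2 (Fin n) => if f = s(y, p₂) then (if p₂ ∈ T then 1 else 0)
          else if f = s(y, p₁) then (if p₁ ∈ T then 1 else 0) else if x ∈ f then 0 else u₀ f)).real (clusterIs y W) *
        A.inf' hA (fun a => (prodBernoulli (fun f : Sym2 (Fin n) => if f = s(y, p₂) then (if p₂ ∈ T then 1 else 0)
          else if f = s(y, p₁) then (if p₁ ∈ T then 1 else 0) else if x ∈ f then 0 else u₀ f)).real (openConnIn ((↑W : Set (Fin n))ᶜ) a b)) := by
  set gT : Sym2 (Fin n) → unitInterval := fun f => if f = s(x, p₂) then (if p₂ ∈ T then 1 else 0)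
    else if f = s(x, p₁) then (if p₁ ∈ T then 1 else 0) else if f = s(x, y) then 1 else u₀ f with hgT
  set g'T : Sym2 (Fin n) → unitInterval := fun f => if f = s(y, p₂) then (if p₂ ∈ T then 1 else 0)
    else if f = s(y, p₁) then (if p₁ ∈ T then 1 else 0) else if x ∈ f then 0 else u₀ f with hg'T
  -- a sure port
  obtain ⟨t, htT⟩ := hT
  have htP : t = p₁ ∨ t = p₂ := by simpa using hTsub htT
  have htA : t ∈ A := by rcases htP with rfl | rfl <;> assumption
  have htx : t ≠ x := by rcases htP with rfl | rfl <;> [exact hxp₁.symm; exact hxp₂.symm]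
  have hty : t ≠ y := by rcases htP with rfl | rfl <;> [exact hyp₁.symm; exact hyp₂.symm]
  -- evaluations
  have hg_xy : gT s(x, y) = 1 := by simp [hgT, hyp₂, hyp₁, hxp₂, hxp₁]
  have hg_xt : ∀ t' ∈ T, gT s(x, t') = 1 := by
    intro t' ht'
    have : t' = p₁ ∨ t' = p₂ := by simpa using hTsub ht'
    rcases this with rfl | rfl
    · simp [hgT, hp, ht', hxp₂]
    · simp [hgT, ht']
  have hg'_iso : ∀ u : Fin n, u ≠ x → g'T s(x, u) = 0 := by
    intro u _
    simp [hg'T, hxy, hxp₁, hxp₂]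
  have hg'_yt : ∀ t' ∈ T, g'T s(y, t') = 1 := by
    intro t' ht'
    have : t' = p₁ ∨ t' = p₂ := by simpa using hTsub ht'
    rcases this with rfl | rfl
    · simp [hg'T, hp, ht', hyp₂]
    · simp [hg'T, ht']
  -- the pendant attachment of `x` to `y` over `g'T`
  set m : Sym2 (Fin n) → unitInterval := fun f => if f = s(x, y) then 1 else g'T f with hm
  have hm_yx : m s(y, x) = 1 := by simp [hm, Sym2.eq_swap]
  have hm_yt : ∀ t' ∈ T, m s(y, t') = 1 := by
    intro t' ht'
    have ht'x : t' ≠ x := by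
      have : t' = p₁ ∨ t' = p₂ := by simpa using hTsub ht'
      rcases this with rfl | rfl; exacts [hxp₁.symm, hxp₂.symm]
    have hne : s(y, t') ≠ s(x, y) := by
      intro h; rcases Sym2.eq_iff.1 h with ⟨h1, _⟩ | ⟨_, h2⟩
      · exact hxy h1.symm
      · exact ht'x h2
    rw [hm]; simp only; rw [if_neg hne]; exact hg'_yt t' ht'
  have hm1 : ∀ z b' : Fin n, z ≠ x → b' ≠ x → (prodBernoulli m).real (openConn z b') = (prodBernoulli g'T).real (openConn z b') :=
    fun z b' hz hb' => real_openConn_attachPendant g'T x y hxy hg'_iso z b' hz hb'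
  have hm2 : (prodBernoulli m).real (openConn x b) = (prodBernoulli g'T).real (openConn y b) :=
    real_openConn_attachPendant_self g'T x y hxy hg'_iso b hbx
  -- the common refinement
  set D₁ : Finset (Sym2 (Fin n)) := T.image (fun t' => s(x, t')) with hD₁
  set D₂ : Finset (Sym2 (Fin n)) := T.image (fun t' => s(y, t')) with hD₂
  set R₁ : Sym2 (Fin n) → unitInterval := fun f => if f ∈ D₁ then 1 else m f with hR₁
  set R₂ : Sym2 (Fin n) → unitInterval := fun f => if f ∈ D₂ then 1 else gT f with hR₂
  have hD₁mem : ∀ f, f ∈ D₁ ↔ ∃ t' ∈ T, s(x, t') = f := fun f => by rw [hD₁, Finset.mem_image]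
  have hD₂mem : ∀ f, f ∈ D₂ ↔ ∃ t' ∈ T, s(y, t') = f := fun f => by rw [hD₂, Finset.mem_image]
  have hTx : ∀ t' ∈ T, t' ≠ x ∧ t' ≠ y := by
    intro t' ht'
    have : t' = p₁ ∨ t' = p₂ := by simpa using hTsub ht'
    rcases this with rfl | rfl
    · exact ⟨hxp₁.symm, hyp₁.symm⟩
    · exact ⟨hxp₂.symm, hyp₂.symm⟩
  have hRel₁ : ∀ z, (prodBernoulli R₁).real (openConn z b) = (prodBernoulli m).real (openConn z b) := by
    intro z
    refine real_openConn_gluePairs_of_asJoined m D₁ (fun e he a ha c hc => ?_) z b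
    obtain ⟨t', ht', rfl⟩ := (hD₁mem e).1 he
    have key : (prodBernoulli m).real (openConn x t')ᶜ = 0 :=
      real_not_openConn_eq_zero_of_hub m y x t' hxy (hTx t' ht').2 hm_yx (hm_yt t' ht')
    rcases Sym2.mem_iff.1 ha with rfl | rfl <;> rcases Sym2.mem_iff.1 hc with rfl | rfl
    · exact real_compl_openConn_self m _
    · exact key
    · rw [openConn_comm]; exact key
    · exact real_compl_openConn_self m _
  have hRel₂ : ∀ z, (prodBernoulli R₂).real (openConn z b) = (prodBernoulli gT).real (openConn z b) := by
    intro z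
    refine real_openConn_gluePairs_of_asJoined gT D₂ (fun e he a ha c hc => ?_) z b
    obtain ⟨t', ht', rfl⟩ := (hD₂mem e).1 he
    have key : (prodBernoulli gT).real (openConn y t')ᶜ = 0 :=
      real_not_openConn_eq_zero_of_hub gT x y t' hxy.symm (hTx t' ht').1 hg_xy (hg_xt t' ht')
    rcases Sym2.mem_iff.1 ha with rfl | rfl <;> rcases Sym2.mem_iff.1 hc with rfl | rfl
    · exact real_compl_openConn_self gT _
    · exact key
    · rw [openConn_comm]; exact key
    · exact real_compl_openConn_self gT _
  have hR : R₁ = R₂ := by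
    funext f
    rw [hR₁, hR₂]; simp only
    by_cases hf1 : f ∈ D₁
    · obtain ⟨t', ht', rfl⟩ := (hD₁mem f).1 hf1
      have hnot : s(x, t') ∉ D₂ := by
        intro h
        obtain ⟨t'', ht'', h''⟩ := (hD₂mem _).1 h
        rcases Sym2.eq_iff.1 h'' with ⟨h1, _⟩ | ⟨_, h2⟩
        · exact hxy h1.symm
        · exact (hTx t'' ht'').1 h2
      rw [if_pos hf1, if_neg hnot, hg_xt t' ht']
    · rw [if_neg hf1]
      by_cases hf2 : f ∈ D₂
      · obtain ⟨t', ht', rfl⟩ := (hD₂mem f).1 hf2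
        rw [if_pos hf2, hm_yt t' ht']
      · rw [if_neg hf2]
        by_cases hf3 : f = s(x, y)
        · subst hf3
          rw [hg_xy]; simp [hm]
        · have hmf : m f = g'T f := by rw [hm]; simp only; rw [if_neg hf3]
          rw [hmf]
          by_cases hfx2 : f = s(x, p₂)
          · subst hfx2
            have hp₂T : p₂ ∉ T := fun h => hf1 ((hD₁mem _).2 ⟨p₂, h, rfl⟩)
            rw [hg'_iso p₂ hxp₂.symm]
            simp [hgT, hp₂T]
          · by_cases hfx1 : f = s(x, p₁)
            · subst hfx1
              have hp₁T : p₁ ∉ T := fun h => hf1 ((hD₁mem _).2 ⟨p₁, h, rfl⟩)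
              rw [hg'_iso p₁ hxp₁.symm]
              simp [hgT, hp₁T, hp, hxp₂]
            · by_cases hfy2 : f = s(y, p₂)
              · subst hfy2
                have hp₂T : p₂ ∉ T := fun h => hf2 ((hD₂mem _).2 ⟨p₂, h, rfl⟩)
                have e1 : g'T s(y, p₂) = 0 := by simp [hg'T, hp₂T]
                have e2 : gT s(y, p₂) = u₀ s(y, p₂) := by
                  simp [hgT, hxy.symm, hxp₂.symm, hyp₁, hyp₂]
                rw [e1, e2, hy0₂]
              · by_cases hfy1 : f = s(y, p₁)
                · subst hfy1
                  have hp₁T : p₁ ∉ T := fun h => hf2 ((hD₂mem _).2 ⟨p₁, h, rfl⟩)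
                  have e1 : g'T s(y, p₁) = 0 := by simp [hg'T, hp₁T, hp, hyp₂]
                  have e2 : gT s(y, p₁) = u₀ s(y, p₁) := by
                    simp [hgT, hxy.symm, hxp₁.symm, hyp₁, hyp₂, hp]
                  rw [e1, e2, hy0₁]
                · have e1 : g'T f = if x ∈ f then 0 else u₀ f := by
                    rw [hg'T]; simp only; rw [if_neg hfy2, if_neg hfy1]
                  have e2 : gT f = u₀ f := by
                    rw [hgT]; simp only; rw [if_neg hfx2, if_neg hfx1, if_neg hf3]
                  rw [e1, e2]
                  by_cases hx : x ∈ f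
                  · rw [if_pos hx]
                    have hof := Sym2.other_spec hx
                    have hz1 : Sym2.Mem.other hx ≠ p₁ := fun h => hfx1 (by rw [← hof, h])
                    have hz2 : Sym2.Mem.other hx ≠ p₂ := fun h => hfx2 (by rw [← hof, h])
                    rw [← hof, hx0 _ hz1 hz2]
                  · rw [if_neg hx]
  -- reliabilities
  have ex : (prodBernoulli gT).real (openConn x b) = (prodBernoulli g'T).real (openConn y b) := by
    rw [← hRel₂ x, ← hR, hRel₁ x, hm2]
  have ej : (prodBernoulli gT).real (openConn j b) = (prodBernoulli g'T).real (openConn j b) := by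
    rw [← hRel₂ j, ← hR, hRel₁ j, hm1 j b hjx hbx]
  -- correction sums vanish on both sides
  have hDx := sum_clusterIs_eq_zero_of_surePair gT A hA x t b htA htx.symm (hg_xt t htT)
  have hDy := sum_clusterIs_eq_zero_of_surePair g'T A hA y t b htA hty.symm (hg'_yt t htT)
  rw [hDx, hDy, ex, ej]

/-- **Hair transfer at the hairless corner**: `x` joined surely to `y` only is the observer `y` of the graph without `x`
(`KNGoodSeriesGlue.agood_wzero_glue_one`). [folklore] -/
theorem agood_transfer_corner_empty (u₀ : Sym2 (Fin n) → unitInterval) (A : Finset (Fin n)) (hA : A.Nonempty)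
    (x y p₁ p₂ j b : Fin n) (hxy : x ≠ y) (hxp₁ : x ≠ p₁) (hxp₂ : x ≠ p₂) (hyp₁ : y ≠ p₁) (hyp₂ : y ≠ p₂)
    (hxA : x ∉ A) (hjA : j ∈ A) (hbx : b ≠ x)
    (hx0 : ∀ z : Fin n, z ≠ p₁ → z ≠ p₂ → u₀ s(x, z) = 0) (hy0₁ : u₀ s(y, p₁) = 0) (hy0₂ : u₀ s(y, p₂) = 0) :
    (prodBernoulli (fun f : Sym2 (Fin n) => if f = s(x, p₂) then 0 else if f = s(x, p₁) then 0
        else if f = s(x, y) then 1 else u₀ f)).real (openConn x b) -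
      (prodBernoulli (fun f : Sym2 (Fin n) => if f = s(x, p₂) then 0 else if f = s(x, p₁) then 0
        else if f = s(x, y) then 1 else u₀ f)).real (openConn j b) +
      ∑ W ∈ nullSets A, (prodBernoulli (fun f : Sym2 (Fin n) => if f = s(x, p₂) then 0
          else if f = s(x, p₁) then 0 else if f = s(x, y) then 1 else u₀ f)).real (clusterIs x W) *
        A.inf' hA (fun a => (prodBernoulli (fun f : Sym2 (Fin n) => if f = s(x, p₂) then 0
          else if f = s(x, p₁) then 0 else if f = s(x, y) then 1 else u₀ f)).real (openConnIn ((↑W : Set (Fin n))ᶜ) a b)) =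
    (prodBernoulli (fun f : Sym2 (Fin n) => if f = s(y, p₂) then 0 else if f = s(y, p₁) then 0
        else if x ∈ f then 0 else u₀ f)).real (openConn y b) -
      (prodBernoulli (fun f : Sym2 (Fin n) => if f = s(y, p₂) then 0 else if f = s(y, p₁) then 0
        else if x ∈ f then 0 else u₀ f)).real (openConn j b) +
      ∑ W ∈ nullSets A, (prodBernoulli (fun f : Sym2 (Fin n) => if f = s(y, p₂) then 0
          else if f = s(y, p₁) then 0 else if x ∈ f then 0 else u₀ f)).real (clusterIs y W) *
        A.inf' hA (fun a => (prodBernoulli (fun f : Sym2 (Fin n) => if f = s(y, p₂) then 0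
          else if f = s(y, p₁) then 0 else if x ∈ f then 0 else u₀ f)).real (openConnIn ((↑W : Set (Fin n))ᶜ) a b)) := by
  set g : Sym2 (Fin n) → unitInterval := fun f => if f = s(x, p₂) then 0 else if f = s(x, p₁) then 0
    else if f = s(x, y) then 1 else u₀ f with hg
  set g' : Sym2 (Fin n) → unitInterval := fun f => if f = s(y, p₂) then 0 else if f = s(y, p₁) then 0
    else if x ∈ f then 0 else u₀ f with hg'
  have hpin : pinW g' {e : Sym2 (Fin n) | x ∈ e ∧ ¬ e.IsDiag} ∅ = g' := by
    funext f
    rw [pinW_apply]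
    by_cases hf : f ∈ {e : Sym2 (Fin n) | x ∈ e ∧ ¬ e.IsDiag}
    · rw [if_pos hf, if_neg (Set.notMem_empty _)]
      have hxf : x ∈ f := hf.1
      symm
      rw [hg']; simp only
      have h1 : f ≠ s(y, p₂) := by
        rintro rfl; rcases Sym2.mem_iff.1 hxf with h | h
        · exact hxy h
        · exact hxp₂ h
      have h2 : f ≠ s(y, p₁) := by
        rintro rfl; rcases Sym2.mem_iff.1 hxf with h | h
        · exact hxy h
        · exact hxp₁ h
      rw [if_neg h1, if_neg h2, if_pos hxf]
    · rw [if_neg hf]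
  have hupd : Function.update (pinW g' {e : Sym2 (Fin n) | x ∈ e ∧ ¬ e.IsDiag} ∅) s(x, y) 1 = g := by
    rw [hpin]
    funext f
    rw [Function.update_apply]
    by_cases hf : f = s(x, y)
    · subst hf
      rw [if_pos rfl, hg]; simp [hyp₂, hyp₁, hxp₂, hxp₁]
    · rw [if_neg hf]
      by_cases hfx2 : f = s(x, p₂)
      · subst hfx2
        have e1 : g' s(x, p₂) = 0 := by simp [hg', hxy, hxp₂, hxp₁]
        have e2 : g s(x, p₂) = 0 := by simp [hg]
        rw [e1, e2]
      · by_cases hfx1 : f = s(x, p₁)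
        · subst hfx1
          have e1 : g' s(x, p₁) = 0 := by simp [hg', hxy, hxp₂, hxp₁]
          have e2 : g s(x, p₁) = 0 := by simp [hg]
          rw [e1, e2]
        · by_cases hfy2 : f = s(y, p₂)
          · subst hfy2
            have e1 : g' s(y, p₂) = 0 := by simp [hg']
            have e2 : g s(y, p₂) = u₀ s(y, p₂) := by simp [hg, hxy.symm, hxp₂.symm, hyp₁, hyp₂]
            rw [e1, e2, hy0₂]
          · by_cases hfy1 : f = s(y, p₁)
            · subst hfy1
              have e1 : g' s(y, p₁) = 0 := by simp [hg']
              have e2 : g s(y, p₁) = u₀ s(y, p₁) := by simp [hg, hxy.symm, hxp₁.symm, hyp₁, hyp₂]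
              rw [e1, e2, hy0₁]
            · have e1 : g' f = if x ∈ f then 0 else u₀ f := by
                rw [hg']; simp only; rw [if_neg hfy2, if_neg hfy1]
              have e2 : g f = u₀ f := by
                rw [hg]; simp only; rw [if_neg hfx2, if_neg hfx1, if_neg hf]
              rw [e1, e2]
              by_cases hx : x ∈ f
              · rw [if_pos hx]
                have hof := Sym2.other_spec hx
                have hz1 : Sym2.Mem.other hx ≠ p₁ := fun h => hfx1 (by rw [← hof, h])
                have hz2 : Sym2.Mem.other hx ≠ p₂ := fun h => hfx2 (by rw [← hof, h])
                rw [← hof, hx0 _ hz1 hz2]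
              · rw [if_neg hx]
  have h := agood_wzero_glue_one g' A hA x y j b hxA hxy.symm hjA hbx
  rw [hupd, hpin] at h
  exact h

/-- **Hair transfer.**  See the module docstring: contracting the sure pair `s(x,y)` moves the two hairs of the pendant star `x` onto `y`
without changing the goodness functional. [cite: KozmaNitzan2024, §3.2 Definition (p. 12), Lemma 5 (p. 13); folklore (contraction of a sure pair)] -/
theorem agood_hairTransfer (u₀ : Sym2 (Fin n) → unitInterval) (A : Finset (Fin n)) (hA : A.Nonempty)
    (x y p₁ p₂ j b : Fin n) (hxy : x ≠ y) (hxp₁ : x ≠ p₁) (hxp₂ : x ≠ p₂) (hyp₁ : y ≠ p₁) (hyp₂ : y ≠ p₂) (hp : p₁ ≠ p₂)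
    (hp₁A : p₁ ∈ A) (hp₂A : p₂ ∈ A) (hxA : x ∉ A) (hjA : j ∈ A) (hbx : b ≠ x)
    (hx0 : ∀ z : Fin n, z ≠ p₁ → z ≠ p₂ → u₀ s(x, z) = 0) (hy0₁ : u₀ s(y, p₁) = 0) (hy0₂ : u₀ s(y, p₂) = 0) :
    (prodBernoulli (Function.update u₀ s(x, y) 1)).real (openConn x b) - (prodBernoulli (Function.update u₀ s(x, y) 1)).real (openConn j b) +
        ∑ W ∈ nullSets A, (prodBernoulli (Function.update u₀ s(x, y) 1)).real (clusterIs x W) *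
          A.inf' hA (fun a => (prodBernoulli (Function.update u₀ s(x, y) 1)).real (openConnIn ((↑W : Set (Fin n))ᶜ) a b)) =
      (prodBernoulli (fun f : Sym2 (Fin n) => if f = s(y, p₁) then u₀ s(x, p₁) else if f = s(y, p₂) then u₀ s(x, p₂) else if x ∈ f then 0 else u₀ f)).real (openConn y b) -
        (prodBernoulli (fun f : Sym2 (Fin n) => if f = s(y, p₁) then u₀ s(x, p₁) else if f = s(y, p₂) then u₀ s(x, p₂) else if x ∈ f then 0 else u₀ f)).real (openConn j b) +
        ∑ W ∈ nullSets A, (prodBernoulli (fun f : Sym2 (Fin n) => if f = s(y, p₁) then u₀ s(x, p₁) else if f = s(y, p₂) then u₀ s(x, p₂) else if x ∈ f then 0 else u₀ f)).real (clusterIs y W) *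
          A.inf' hA (fun a => (prodBernoulli (fun f : Sym2 (Fin n) => if f = s(y, p₁) then u₀ s(x, p₁) else if f = s(y, p₂) then u₀ s(x, p₂) else if x ∈ f then 0 else u₀ f)).real (openConnIn ((↑W : Set (Fin n))ᶜ) a b)) := by
  have hjx : j ≠ x := fun h => hxA (h ▸ hjA)
  set us : Sym2 (Fin n) → unitInterval := Function.update u₀ s(x, y) 1 with hus
  set W₁ : Sym2 (Fin n) → unitInterval := fun f : Sym2 (Fin n) => if f = s(y, p₁) then u₀ s(x, p₁) else if f = s(y, p₂) then u₀ s(x, p₂) else if x ∈ f then 0 else u₀ f with hW₁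
  -- values of the four hairs
  have hne1 : s(x, p₁) ≠ s(x, y) := fun h => hyp₁ (Sym2.congr_right.1 h).symm
  have hne2 : s(x, p₂) ≠ s(x, y) := fun h => hyp₂ (Sym2.congr_right.1 h).symm
  have hne12 : s(x, p₂) ≠ s(x, p₁) := fun h => hp (Sym2.congr_right.1 h).symm
  have hne12' : s(y, p₂) ≠ s(y, p₁) := fun h => hp (Sym2.congr_right.1 h).symm
  have hus1 : us s(x, p₁) = u₀ s(x, p₁) := by rw [hus, Function.update_of_ne hne1]
  have hus2 : ∀ c : unitInterval, Function.update us s(x, p₁) c s(x, p₂) = u₀ s(x, p₂) := fun c => by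
    rw [Function.update_of_ne hne12, hus, Function.update_of_ne hne2]
  have hW1 : W₁ s(y, p₁) = u₀ s(x, p₁) := by rw [hW₁]; simp
  have hW2 : ∀ c : unitInterval, Function.update W₁ s(y, p₁) c s(y, p₂) = u₀ s(x, p₂) := fun c => by
    rw [Function.update_of_ne hne12', hW₁]; simp [hne12']
  -- normal forms of the corner weightings
  have hUupd : ∀ c₁ c₂ : unitInterval, Function.update (Function.update us s(x, p₁) c₁) s(x, p₂) c₂ =
      fun f : Sym2 (Fin n) => if f = s(x, p₂) then c₂ else if f = s(x, p₁) then c₁ else if f = s(x, y) then 1 else u₀ f := by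
    intro c₁ c₂; funext f; simp only [hus, Function.update_apply]
  have hWupd : ∀ c₁ c₂ : unitInterval, Function.update (Function.update W₁ s(y, p₁) c₁) s(y, p₂) c₂ =
      fun f : Sym2 (Fin n) => if f = s(y, p₂) then c₂ else if f = s(y, p₁) then c₁ else if x ∈ f then 0 else u₀ f := by
    intro c₁ c₂; funext f
    by_cases h2 : f = s(y, p₂)
    · subst h2; rw [Function.update_self]; simp
    · rw [Function.update_of_ne h2]
      by_cases h1 : f = s(y, p₁)
      · subst h1; rw [Function.update_self]; simp [hp, hyp₂]
      · rw [Function.update_of_ne h1, hW₁]; simp [h1, h2]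
  -- affine expansions in the two hairs, both sides
  have eL := agood_affine_pair us A hA x p₁ j b (us s(x, p₁))
  rw [Function.update_eq_self, hus1] at eL
  have eL0 := agood_affine_pair (Function.update us s(x, p₁) 0) A hA x p₂ j b (Function.update us s(x, p₁) 0 s(x, p₂))
  rw [Function.update_eq_self, hus2] at eL0
  have eL1 := agood_affine_pair (Function.update us s(x, p₁) 1) A hA x p₂ j b (Function.update us s(x, p₁) 1 s(x, p₂))
  rw [Function.update_eq_self, hus2] at eL1
  have eR := agood_affine_pair W₁ A hA y p₁ j b (W₁ s(y, p₁))
  rw [Function.update_eq_self, hW1] at eR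
  have eR0 := agood_affine_pair (Function.update W₁ s(y, p₁) 0) A hA y p₂ j b (Function.update W₁ s(y, p₁) 0 s(y, p₂))
  rw [Function.update_eq_self, hW2] at eR0
  have eR1 := agood_affine_pair (Function.update W₁ s(y, p₁) 1) A hA y p₂ j b (Function.update W₁ s(y, p₁) 1 s(y, p₂))
  rw [Function.update_eq_self, hW2] at eR1
  -- the four corners
  have m11 : p₁ ∈ ({p₁, p₂} : Finset (Fin n)) := by simp
  have m22 : p₂ ∈ ({p₁, p₂} : Finset (Fin n)) := by simp
  have m1 : p₁ ∈ ({p₁} : Finset (Fin n)) := Finset.mem_singleton_self p₁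
  have m2 : p₂ ∈ ({p₂} : Finset (Fin n)) := Finset.mem_singleton_self p₂
  have n21 : p₂ ∉ ({p₁} : Finset (Fin n)) := by simp [hp.symm]
  have n12 : p₁ ∉ ({p₂} : Finset (Fin n)) := by simp [hp]
  have c11 := agood_transfer_corner u₀ A {p₁, p₂} hA x y p₁ p₂ j b hxy hxp₁ hxp₂ hyp₁ hyp₂ hp hp₁A hp₂A
    (subset_refl _) ⟨p₁, m11⟩ hjx hbx hx0 hy0₁ hy0₂
  simp only [if_pos m11, if_pos m22] at c11
  have c10 := agood_transfer_corner u₀ A {p₁} hA x y p₁ p₂ j b hxy hxp₁ hxp₂ hyp₁ hyp₂ hp hp₁A hp₂A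
    (by simp) ⟨p₁, m1⟩ hjx hbx hx0 hy0₁ hy0₂
  simp only [if_pos m1, if_neg n21] at c10
  have c01 := agood_transfer_corner u₀ A {p₂} hA x y p₁ p₂ j b hxy hxp₁ hxp₂ hyp₁ hyp₂ hp hp₁A hp₂A
    (by simp) ⟨p₂, m2⟩ hjx hbx hx0 hy0₁ hy0₂
  simp only [if_pos m2, if_neg n12] at c01
  have c00 := agood_transfer_corner_empty u₀ A hA x y p₁ p₂ j b hxy hxp₁ hxp₂ hyp₁ hyp₂ hxA hjA hbx hx0 hy0₁ hy0₂
  rw [← hUupd 1 1, ← hWupd 1 1] at c11; rw [← hUupd 1 0, ← hWupd 1 0] at c10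
  rw [← hUupd 0 1, ← hWupd 0 1] at c01; rw [← hUupd 0 0, ← hWupd 0 0] at c00
  rw [eL, eL0, eL1, eR, eR0, eR1, c00, c01, c10, c11]

end KNGoodTwoTwo

end

end Summit.CriticalPhenomena.PercolationContinuityZ3.Theorems
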